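import Summits.CriticalPhenomena.PercolationContinuityZ3.Theorems.PercNearOneGluingNoHeavyLowerTailKnQuestion8CoefficientwiseCoreClassKernelMixThreadWords

/-!
# Thread words, II: digon and loop words, and the cluster decomposition (L5 link, part 2b)

Support file (`--supports stmt-CriticalPhenomena-4575`, closed), prover `prim-cplus-coupling` (gen 67).  No notations, no named facts, no sorries;
standard axioms.  Memo `prim-cplus-coupling/A5-COUPLING-gen66.md` §7.2 and `A5-COUPLING-gen67.md` §1.  Continues `…KernelMixThreadWords`.

* `ℓ = 2` (digon `u — wv 1 — b`): `wordD ed σ : Bool × Bool` (the `SmallCycles` digon factor), blue-run set `YtD` = the middle vertex unless both edges are red;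
  `ytD_wordD`, `ytD_off_top`, `wordD_le_iff`, `wordD_sdiff`, `wordD_eq_top_iff`, `wordD_surj`.
* `ℓ = 1` (loop, a unit thread `u — b`): `wordL ed σ : Bool`; no interior vertex (`ThreadWords.bRun_one`); `wordL_le_iff`, `wordL_sdiff`, `wordL_eq_true_iff`, `wordL_surj`.
* CLUSTER DECOMPOSITION `bundle_cluster_eq_runs`: on an explicit bundle, if `b ∈ C_u(E ∖ σ)` then `C_u(E ∖ σ) = {u, b} ∪ ⋃_t bRun_t(σ)`
  (`bundle_cluster_subset_runs` + `bundle_prefix_mem_cluster` + `bundle_suffix_mem_cluster`).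
[cite: KozmaNitzan2024, Questions 8–9 (§5.5 p. 36) (context); Harris 1960]
-/

namespace Summit.CriticalPhenomena.PercolationContinuityZ3.Theorems.Coefficientwise.ThreadWords

open Finset CycleWords CycleFactor Literature.Probability.Percolation

variable {ι V : Type*}

/-! ## Digon words (`ℓ = 2`) -/

open Classical in
/-- The digon word of a thread of length two. -/
noncomputable def wordD (ed : ℕ → ι) (σ : Finset ι) : Bool × Bool := (decide (ed 1 ∈ σ), decide (ed 2 ∈ σ))

/-- The blue-run set read off a digon word: the middle vertex, unless both edges are red. -/
def YtD (wv : ℕ → V) (w : Bool × Bool) : Set V := {x | x = wv 1 ∧ (w.1 = false ∨ w.2 = false)}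

open Classical in
/-- **The word determines the blue-run set** (digon case). -/
theorem ytD_wordD (wv : ℕ → V) (ed : ℕ → ι) (σ : Finset ι) : YtD wv (wordD ed σ) = bRun 2 wv ed σ := by
  ext x
  simp only [YtD, wordD, bRun, Set.mem_setOf_eq, decide_eq_false_iff_not]
  constructor
  · rintro ⟨rfl, h⟩
    refine ⟨1, le_rfl, by omega, rfl, ?_⟩
    rcases h with h | h
    · exact Or.inl fun j' h1 h2 => by obtain rfl : j' = 1 := le_antisymm h2 h1; exact h
    · exact Or.inr fun j' h1 h2 => by obtain rfl : j' = 2 := le_antisymm h2 h1; exact h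
  · rintro ⟨j, hj1, hj2, rfl, h⟩
    obtain rfl : j = 1 := by omega
    refine ⟨rfl, ?_⟩
    rcases h with h | h
    · exact Or.inl (h 1 le_rfl le_rfl)
    · exact Or.inr (h 2 (by omega) le_rfl)

/-- **`YtD` is maximal at every non-full word.** -/
theorem ytD_off_top (wv : ℕ → V) (w w' : Bool × Bool) (hw : w ≠ (true, true)) : YtD wv w' ⊆ YtD wv w := by
  rintro x ⟨rfl, -⟩
  refine ⟨rfl, ?_⟩
  obtain ⟨a, c⟩ := w
  revert hw; cases a <;> cases c <;> simp

open Classical in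
/-- The digon word only depends on the colours of the thread's own edges. -/
theorem wordD_congr (ed : ℕ → ι) {σ σ' : Finset ι} (h : ∀ j, 1 ≤ j → j ≤ 2 → (ed j ∈ σ ↔ ed j ∈ σ')) : wordD ed σ = wordD ed σ' := by
  simp only [wordD, Prod.mk.injEq]
  refine ⟨?_, ?_⟩
  · rw [Bool.eq_iff_iff, decide_eq_true_iff, decide_eq_true_iff]; exact h 1 le_rfl (by omega)
  · rw [Bool.eq_iff_iff, decide_eq_true_iff, decide_eq_true_iff]; exact h 2 (by omega) le_rfl

open Classical in
/-- **The digon word is an order embedding.** -/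
theorem wordD_le_iff (ed : ℕ → ι) (σ σ' : Finset ι) :
    wordD ed σ ≤ wordD ed σ' ↔ ∀ j, 1 ≤ j → j ≤ 2 → ed j ∈ σ → ed j ∈ σ' := by
  constructor
  · intro hle j hj1 hj2 hj
    have ha := Bool.le_iff_imp.mp hle.1
    have hc := Bool.le_iff_imp.mp hle.2
    simp only [wordD, decide_eq_true_eq] at ha hc
    by_cases h1 : j = 1
    · subst h1; exact ha hj
    · obtain rfl : j = 2 := by omega
      exact hc hj
  · intro h
    refine ⟨Bool.le_iff_imp.mpr ?_, Bool.le_iff_imp.mpr ?_⟩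
    · simp only [wordD, decide_eq_true_eq]; exact h 1 le_rfl (by omega)
    · simp only [wordD, decide_eq_true_eq]; exact h 2 (by omega) le_rfl

open Classical in
/-- **The digon word of the complementary colouring is the mirror word.** -/
theorem wordD_sdiff (ed : ℕ → ι) (F σ : Finset ι) (hF : ∀ j, 1 ≤ j → j ≤ 2 → ed j ∈ F) :
    wordD ed (F \ σ) = (!(wordD ed σ).1, !(wordD ed σ).2) := by
  simp only [wordD, Prod.mk.injEq]
  refine ⟨?_, ?_⟩
  · rw [Bool.eq_iff_iff]; simp [mem_sdiff, hF 1 le_rfl (by omega)]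
  · rw [Bool.eq_iff_iff]; simp [mem_sdiff, hF 2 (by omega) le_rfl]

open Classical in
/-- **The digon word is `(R,R)` iff the thread is fully red.** -/
theorem wordD_eq_top_iff (ed : ℕ → ι) (σ : Finset ι) : wordD ed σ = (true, true) ↔ ∀ j, 1 ≤ j → j ≤ 2 → ed j ∈ σ := by
  simp only [wordD, Prod.mk.injEq, decide_eq_true_eq]
  constructor
  · rintro ⟨h1, h2⟩ j hj1 hj2
    by_cases h : j = 1
    · subst h; exact h1
    · obtain rfl : j = 2 := by omega
      exact h2
  · intro h; exact ⟨h 1 le_rfl (by omega), h 2 (by omega) le_rfl⟩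

open Classical in
/-- **Every digon word is the word of a colouring of the thread.** -/
theorem wordD_surj (ed : ℕ → ι) (hed : ∀ i j, 1 ≤ i → i ≤ 2 → 1 ≤ j → j ≤ 2 → ed i = ed j → i = j)
    (At : Finset ι) (hAt : ∀ i, i ∈ At ↔ ∃ j, 1 ≤ j ∧ j ≤ 2 ∧ ed j = i) (wd : Bool × Bool) :
    ∃ ρ : Finset ι, ρ ⊆ At ∧ wordD ed ρ = wd := by
  obtain ⟨a, c⟩ := wd
  refine ⟨At.filter (fun i => (i = ed 1 ∧ a = true) ∨ (i = ed 2 ∧ c = true)), filter_subset _ _, ?_⟩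
  have h12 : ed 1 ≠ ed 2 := fun h => by have := hed 1 2 le_rfl (by omega) (by omega) le_rfl h; omega
  have hA1 : ed 1 ∈ At := (hAt _).mpr ⟨1, le_rfl, by omega, rfl⟩
  have hA2 : ed 2 ∈ At := (hAt _).mpr ⟨2, by omega, le_rfl, rfl⟩
  simp only [wordD, Prod.mk.injEq]
  refine ⟨?_, ?_⟩
  · rw [Bool.eq_iff_iff, decide_eq_true_iff, mem_filter]
    constructor
    · rintro ⟨-, ⟨-, h⟩ | ⟨h, -⟩⟩
      · exact h
      · exact absurd h h12
    · exact fun h => ⟨hA1, Or.inl ⟨rfl, h⟩⟩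
  · rw [Bool.eq_iff_iff, decide_eq_true_iff, mem_filter]
    constructor
    · rintro ⟨-, ⟨h, -⟩ | ⟨-, h⟩⟩
      · exact absurd h.symm h12
      · exact h
    · exact fun h => ⟨hA2, Or.inr ⟨rfl, h⟩⟩

/-! ## Loop words (`ℓ = 1`) -/

open Classical in
/-- The loop word of a unit thread: the colour of its edge. -/
noncomputable def wordL (ed : ℕ → ι) (σ : Finset ι) : Bool := decide (ed 1 ∈ σ)

open Classical in
/-- The loop word only depends on the colour of the edge. -/
theorem wordL_congr (ed : ℕ → ι) {σ σ' : Finset ι} (h : ed 1 ∈ σ ↔ ed 1 ∈ σ') : wordL ed σ = wordL ed σ' := by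
  rw [wordL, wordL, Bool.eq_iff_iff, decide_eq_true_iff, decide_eq_true_iff]; exact h

open Classical in
/-- **The loop word is an order embedding.** -/
theorem wordL_le_iff (ed : ℕ → ι) (σ σ' : Finset ι) : wordL ed σ ≤ wordL ed σ' ↔ (ed 1 ∈ σ → ed 1 ∈ σ') := by
  rw [Bool.le_iff_imp]; simp [wordL]

open Classical in
/-- **The loop word of the complementary colouring is the negated word.** -/
theorem wordL_sdiff (ed : ℕ → ι) (F σ : Finset ι) (hF : ed 1 ∈ F) : wordL ed (F \ σ) = !(wordL ed σ) := by
  rw [wordL, wordL, Bool.eq_iff_iff]; simp [mem_sdiff, hF]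

open Classical in
/-- **The loop word is `R` iff the edge is red.** -/
theorem wordL_eq_true_iff (ed : ℕ → ι) (σ : Finset ι) : wordL ed σ = true ↔ ed 1 ∈ σ := by
  simp [wordL]

open Classical in
/-- **Every loop word is the word of a colouring.** -/
theorem wordL_surj (ed : ℕ → ι) (At : Finset ι) (hAt : ed 1 ∈ At) (wd : Bool) : ∃ ρ : Finset ι, ρ ⊆ At ∧ wordL ed ρ = wd := by
  cases wd
  · exact ⟨∅, empty_subset _, by simp [wordL]⟩
  · exact ⟨{ed 1}, singleton_subset_iff.mpr hAt, by simp [wordL]⟩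

/-! ## The cluster decomposition on an explicit bundle -/

open Classical in
/-- **Cluster decomposition.**  On an explicit bundle (`r ≥ 1` threads), for a colouring `σ` with `b ∈ C_u(E ∖ σ)` (some thread fully blue), the blue cluster
of `u` is `{u, b}` together with the blue-run sets of all threads.  [folklore; `bundle_cluster_subset_runs` + the two run lemmas] -/
theorem bundle_cluster_eq_runs (ends : ι → Sym2 V) (r : ℕ) (L : ℕ → ℕ)
    (w : ℕ → ℕ → V) (e : ℕ → ℕ → ι) (u b : V) (hr : 0 < r)
    (hw0 : ∀ t, t < r → w t 0 = u) (hwL : ∀ t, t < r → w t (L t) = b)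
    (harc : ∀ t, t < r → ∀ j, 1 ≤ j → j ≤ L t → ends (e t j) = s(w t (j - 1), w t j))
    (hwinj : ∀ t, t < r → ∀ i j, i ≤ L t → j ≤ L t → w t i = w t j → i = j)
    (hcross : ∀ t t', t < r → t' < r → t ≠ t' → ∀ i j, i ≤ L t → j ≤ L t' → w t i = w t' j → (i = 0 ∧ j = 0) ∨ (i = L t ∧ j = L t'))
    (E : Finset ι) (hE : ∀ i, i ∈ E → ∃ t, t < r ∧ ∃ j, 1 ≤ j ∧ j ≤ L t ∧ e t j = i)
    (heE : ∀ t, t < r → ∀ j, 1 ≤ j → j ≤ L t → e t j ∈ E)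
    (σ : Finset ι) (hb : b ∈ openCluster (ends '' (↑(E \ σ) : Set ι)) u) :
    openCluster (ends '' (↑(E \ σ) : Set ι)) u = {x | x = u ∨ x = b ∨ ∃ t, t < r ∧ x ∈ bRun (L t) (w t) (e t) σ} := by
  apply Set.Subset.antisymm
  · intro x hx
    have h := bundle_cluster_subset_runs ends r L w e u b hw0 hwL harc hwinj hcross E hE (E \ σ) sdiff_subset hx
    rcases h with h | h | ⟨t, ht, j, hj1, hjL, hx, hruns⟩
    · exact Or.inl h
    · exact Or.inr (Or.inl h)
    · refine Or.inr (Or.inr ⟨t, ht, j, hj1, hjL, hx, ?_⟩)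
      rcases hruns with h | h
      · exact Or.inl fun j' h1 h2 => (mem_sdiff.mp (h j' h1 h2)).2
      · exact Or.inr fun j' h1 h2 => (mem_sdiff.mp (h j' h1 h2)).2
  · rintro x (rfl | rfl | ⟨t, ht, j, hj1, hjL, rfl, hruns⟩)
    · have := bundle_prefix_mem_cluster ends r L w e x hw0 harc (E \ σ) 0 hr 0 (Nat.zero_le _) (fun j' h1 h2 => by omega)
      rwa [hw0 0 hr] at this
    · exact hb
    · rcases hruns with h | h
      · exact bundle_prefix_mem_cluster ends r L w e u hw0 harc (E \ σ) t ht j (le_of_lt hjL)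
          (fun j' h1 h2 => mem_sdiff.mpr ⟨heE t ht j' h1 (by omega), h j' h1 h2⟩)
      · exact bundle_suffix_mem_cluster ends r L w e u b hwL harc (E \ σ) hb t ht j (le_of_lt hjL)
          (fun j' h1 h2 => mem_sdiff.mpr ⟨heE t ht j' (by omega) h2, h j' h1 h2⟩)

end Summit.CriticalPhenomena.PercolationContinuityZ3.Theorems.Coefficientwise.ThreadWords
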